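import Summits.Schanuel.Schanuel.Theorems.ZilberEacRealHyperplaneFast
import HarnessLib

/-!
# THEOREM R⁺⁺ for diagonal targets in ℂ³ × ℂ³, and a solved member of EC(3,2) outside R/R⁺

Zilber's Exponential-Algebraic Closedness, case ladder (host summit Schanuel, cell `pub-schanuel`,
seat 2, gen 8).  The mixed-regime theorem `exists_expPoint_realHyperplane_mixed` specialised to the
3-folds `V = {x₃ = r₀ x₁ + r₁ x₂ + c, y₁ = x₁ + y₃ F₀(y₃), y₂ = x₂ + y₃ F₁(y₃)} ⊆ ℂ³ × ℂ³` (additive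
projection the real plane `x₃ = r₀x₁ + r₁x₂ + c`, `dim π V = 2 = n - 1`: the first open rung,
members of `EC(3,2)` when `1, r₀, r₁` are `ℚ`-linearly independent), i.e. to the systems
`e^{z} = z + e^{ℓ} F₀(e^{ℓ})`, `e^{w} = w + e^{ℓ} F₁(e^{ℓ})`, `ℓ = r₀ z + r₁ w + c`:

* `exists_expPoint_mixed_diag` — solutions exist whenever `r₀ ≠ 0 ≠ r₁`, `F₀ ≠ 0`,
  `deg F₁ < deg F₀` (or `F₁ = 0`) and `(1/(1 + deg F₀) - r₁)/r₀ < 1` — the fast fibre is `y₁`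
  (lattice direction `q = (0, 1)` in the transformed coordinates);
* `sqrt_two_sqrt_three_mixed_system_solvable` — `e^{z} = z + e^{2(√2 z + √3 w)}`,
  `e^{w} = w + e^{√2 z + √3 w}` has a solution: here `λ = √2 + √3 > 0` and `λ (1 + deg F₀) = 2λ > 1`,
  so THEOREMS R/R⁺ do not apply; the base plane `x₃ = √2 x₁ + √3 x₂` is additively free.

Also the linear-form bookkeeping `totalDegree_linearForm` / `eval_leadingForm_linearForm`.

HONEST FRAMING: explicit new members of the OPEN cell `ECCell 3 2` solved; `EC(3,2)` itself, density of
these 3-folds, NOT Schanuel's conjecture; EAC ⇏ SC.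
-/

noncomputable section

open Complex MvPolynomial Filter Topology
open Literature.NumberTheory.Transcendental Literature.ModelTheory.Zilber

set_option linter.dupNamespace false

namespace Summit.Schanuel.Schanuel.Theorems

/-! ## Part 1. Linear forms: total degree `1` and leading form -/

section LinearForm

variable {n : ℕ}

/-- The homogeneous part of a linear form is homogeneous of degree `1`. [folklore] -/
theorem isHomogeneous_sum_C_mul_X (l : Fin n → ℂ) :
    (∑ i, C (l i) * X i : MvPolynomial (Fin n) ℂ).IsHomogeneous 1 :=
  IsHomogeneous.sum _ _ _ fun i _ => isHomogeneous_C_mul_X (l i) i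

/-- **A linear form with a nonzero coefficient has total degree `1`.** [folklore] -/
theorem totalDegree_linearForm (l : Fin n → ℂ) (l₀ : ℂ) {k : Fin n} (hk : l k ≠ 0) :
    (∑ i, C (l i) * X i + C l₀ : MvPolynomial (Fin n) ℂ).totalDegree = 1 := by
  classical
  apply le_antisymm
  · refine (totalDegree_add _ _).trans (max_le (isHomogeneous_sum_C_mul_X l).totalDegree_le ?_)
    rw [totalDegree_C]; exact zero_le_one
  · have hcoeff : coeff (Finsupp.single k 1) (∑ i, C (l i) * X i + C l₀ : MvPolynomial (Fin n) ℂ) = l k := by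
      rw [coeff_add, coeff_sum, coeff_C, if_neg (by
        intro h
        have := congrArg (fun f => f k) h
        simp at this)]
      rw [Finset.sum_eq_single k]
      · rw [coeff_C_mul, coeff_X, if_pos rfl, mul_one, add_zero]
      · intro i _ hik
        rw [coeff_C_mul, coeff_X, if_neg, mul_zero]
        intro h
        exact hik (Finsupp.single_left_injective one_ne_zero h)
      · intro h; exact absurd (Finset.mem_univ k) h
    have hmem : Finsupp.single k 1 ∈ (∑ i, C (l i) * X i + C l₀ : MvPolynomial (Fin n) ℂ).support := by
      rw [mem_support_iff, hcoeff]; exact hk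
    have := le_totalDegree hmem
    rwa [Finsupp.sum_single_index rfl] at this

/-- **The leading form of such a linear form at `v` is `Σ lᵢ vᵢ`.** [folklore] -/
theorem eval_leadingForm_linearForm (l : Fin n → ℂ) (l₀ : ℂ) {k : Fin n} (hk : l k ≠ 0)
    (v : Fin n → ℂ) :
    eval v (homogeneousComponent (∑ i, C (l i) * X i + C l₀ : MvPolynomial (Fin n) ℂ).totalDegree
      (∑ i, C (l i) * X i + C l₀ : MvPolynomial (Fin n) ℂ)) = ∑ i, l i * v i := by
  rw [totalDegree_linearForm l l₀ hk, map_add,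
    homogeneousComponent_eq_self (isHomogeneous_sum_C_mul_X l),
    homogeneousComponent_of_mem (isHomogeneous_C (σ := Fin n) l₀), if_neg one_ne_zero, add_zero,
    map_sum]
  refine Finset.sum_congr rfl fun i _ => ?_
  rw [map_mul, eval_C, eval_X]

end LinearForm

/-! ## Part 2. Diagonal targets in `ℂ³ × ℂ³` -/

section Diag

/-- **THEOREM R⁺⁺ for diagonal targets** `y₁ = x₁ + y₃F₀(y₃)`, `y₂ = x₂ + y₃F₁(y₃)` over the real plane
`x₃ = r₀ x₁ + r₁ x₂ + c`: if `r₀ ≠ 0 ≠ r₁`, `F₀ ≠ 0`, `F₁ = 0 ∨ deg F₁ < deg F₀`, and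
`(1/(1 + deg F₀) - r₁)/r₀ < 1`, the system `e^{z} = z + e^{ℓ}F₀(e^{ℓ})`, `e^{w} = w + e^{ℓ}F₁(e^{ℓ})`
(`ℓ = r₀z + r₁w + c`) has a solution (indeed one near every large lattice centre of the transformed
system). (new) [cite: MantovaMasser2023, §1 p.5 (the open case dim π(V) = 2 in ℂ³×ℂˣ³)] -/
theorem exists_expPoint_mixed_diag {r₀ r₁ : ℝ} (hr₀ : r₀ ≠ 0) (hr₁ : r₁ ≠ 0) (c : ℂ)
    {F₀ : Polynomial ℂ} (hF₀ : F₀ ≠ 0) (F₁ : Polynomial ℂ) (hdeg : F₁ = 0 ∨ F₁.natDegree < F₀.natDegree)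
    (hν : ((1 : ℝ) / (F₀.natDegree + 1) - r₁) / r₀ < 1) :
    ∃ z w : ℂ, exp z = z + exp (r₀ * z + r₁ * w + c) * F₀.eval (exp (r₀ * z + r₁ * w + c)) ∧
      exp w = w + exp (r₀ * z + r₁ * w + c) * F₁.eval (exp (r₀ * z + r₁ * w + c)) := by
  classical
  set r : Fin 2 → ℝ := ![r₀, r₁] with hr
  set A : Fin 2 → MvPolynomial (Fin 2) ℂ := fun j => X j with hAdef
  set F : Fin 2 → Polynomial ℂ := ![F₀, F₁] with hFdef
  set q : Fin 2 → ℤ := ![0, 1] with hq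
  have hr0 : r 0 = r₀ := rfl
  have hr1 : r 1 = r₁ := rfl
  have hF0 : F 0 = F₀ := rfl
  have hF1 : F 1 = F₁ := rfl
  set e : ℕ := F₀.natDegree + 1 with he
  set c₀ : ℂ := F₀.leadingCoeff with hc₀
  have hc0 : c₀ ≠ 0 := Polynomial.leadingCoeff_ne_zero.2 hF₀
  have he0 : (e : ℂ) ≠ 0 := by exact_mod_cast (show e ≠ 0 by positivity)
  have hr0' : (r₀ : ℂ) ≠ 0 := by exact_mod_cast hr₀
  -- the transformed polynomials
  set l : Fin 2 → ℂ := ![-c₀⁻¹ * ((r₀ : ℂ)⁻¹ * (e : ℂ)⁻¹), c₀⁻¹ * ((r₀ : ℂ)⁻¹ * (r₁ : ℂ))] with hl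
  have hA0 : fastData r c A F 0 = ∑ i, C (l i) * X i + C (c₀⁻¹ * ((r₀ : ℂ)⁻¹ * c)) := by
    rw [fastData_zero, hAdef]
    simp only [aeval_X, fastSubst, Fin.cons_zero, hF0, Fin.sum_univ_one]
    rw [show (Fin.succ (0 : Fin 1) : Fin 2) = 1 from rfl, hr0, hr1]
    simp only [Fin.sum_univ_two, hl, Matrix.cons_val_zero, Matrix.cons_val_one, map_neg, map_mul, ← hc₀,
      ← he]
    ring
  have hA1 : fastData r c A F 1 = X 1 := by
    rw [show (1 : Fin 2) = Fin.succ (0 : Fin 1) from rfl, fastData_succ, hAdef]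
    simp only [aeval_X, fastSubst, Fin.cons_succ]
  have hl1 : l 1 ≠ 0 := by
    simp only [hl, Matrix.cons_val_one, Matrix.cons_val_fin_one]
    have : (r₁ : ℂ) ≠ 0 := by exact_mod_cast hr₁
    exact mul_ne_zero (inv_ne_zero hc0) (mul_ne_zero (inv_ne_zero hr0') this)
  have hdeg0 : (fastData r c A F 0).totalDegree = 1 := by
    rw [hA0]; exact totalDegree_linearForm l _ hl1
  have hdeg1 : (fastData r c A F 1).totalDegree = 1 := by rw [hA1, totalDegree_X]
  -- hypotheses of THEOREM R⁺⁺
  have hpi : (2 * (Real.pi : ℂ) * I) ≠ 0 := by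
    have := Real.pi_pos
    simp [Complex.ext_iff, this.ne']
  have hv : (fun i : Fin 2 => 2 * Real.pi * I * ((q i : ℤ) : ℂ)) = ![0, 2 * Real.pi * I] := by
    funext i; fin_cases i <;> simp [hq]
  have hA : ∀ j, eval (fun i => 2 * Real.pi * I * (q i : ℂ))
      (homogeneousComponent (fastData r c A F j).totalDegree (fastData r c A F j)) ≠ 0 := by
    rw [hv]
    refine Fin.forall_fin_two.2 ⟨?_, ?_⟩
    · rw [hA0, eval_leadingForm_linearForm l _ hl1, Fin.sum_univ_two]
      simp only [Matrix.cons_val_zero, Matrix.cons_val_one, mul_zero, zero_add]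
      exact mul_ne_zero hl1 hpi
    · rw [hA1, totalDegree_X, homogeneousComponent_eq_self (isHomogeneous_X ℂ 1), eval_X]
      have h1 : (![(0 : ℂ), 2 * Real.pi * I] : Fin 2 → ℂ) 1 = 2 * Real.pi * I := rfl
      rw [h1]; exact hpi
  have hd0 : 0 < (fastData r c A F 0).totalDegree := by rw [hdeg0]; exact one_pos
  have hν' : (((fastData r c A F 0).totalDegree : ℝ) / ((F 0).natDegree + 1) -
      ∑ i : Fin 1, r i.succ * (fastData r c A F i.succ).totalDegree) / r 0 <
      (fastData r c A F 0).totalDegree := by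
    rw [Fin.sum_univ_one, show (Fin.succ (0 : Fin 1) : Fin 2) = 1 from rfl, hdeg0, hdeg1, hF0, hr0, hr1]
    simpa using hν
  have hfast : ∀ i : Fin 1, F i.succ ≠ 0 →
      ((fastData r c A F 0).totalDegree : ℝ) * ((F i.succ).natDegree + 1) <
        ((F 0).natDegree + 1) * (fastData r c A F i.succ).totalDegree := by
    intro i hFi
    rw [Fin.fin_one_eq_zero i, show (Fin.succ (0 : Fin 1) : Fin 2) = 1 from rfl, hdeg0, hdeg1, hF0, hF1]
    rw [Fin.fin_one_eq_zero i, show (Fin.succ (0 : Fin 1) : Fin 2) = 1 from rfl, hF1] at hFi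
    rcases hdeg with h | h
    · exact absurd h hFi
    · push_cast
      have : (F₁.natDegree : ℝ) < F₀.natDegree := by exact_mod_cast h
      linarith
  obtain ⟨m, z, -, hsys⟩ := (exists_expPoint_realHyperplane_mixed r hr₀ c q A F hF₀ hA hd0 hν' hfast).exists
  set x : Fin 2 → ℂ := fastBack r c (F₀.natDegree + 1) z with hx
  have hℓ : ell r c x = r₀ * x 0 + r₁ * x 1 + c := by
    rw [ell, Fin.sum_univ_two, hr0, hr1]
  refine ⟨x 0, x 1, ?_, ?_⟩
  · have h := hsys 0
    rw [hF0, hℓ, hAdef, eval_X] at h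
    exact h
  · have h := hsys 1
    rw [hF0, hF1, hℓ, hAdef, eval_X] at h
    exact h

/-- **A solved member of `EC(3,2)` outside THEOREMS R/R⁺**: there are `z, w ∈ ℂ` with
`e^{z} = z + e^{2(√2 z + √3 w)}` and `e^{w} = w + e^{√2 z + √3 w}` — exponential point of the 3-fold
`{x₃ = √2 x₁ + √3 x₂, y₁ = x₁ + y₃², y₂ = x₂ + y₃}` (base plane additively free; `λ = √2 + √3`,
`2λ > 1 = deg A₁`, so the slow-regime theorems do not apply; here `(1/2 - √3)/√2 < 1`). (new)
[cite: MantovaMasser2023, §1 p.5 (the open case dim π(V) = 2 in ℂ³×ℂˣ³)] -/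
theorem sqrt_two_sqrt_three_mixed_system_solvable :
    ∃ z w : ℂ, exp z = z + exp (2 * ((Real.sqrt 2 : ℝ) * z + (Real.sqrt 3 : ℝ) * w)) ∧
      exp w = w + exp ((Real.sqrt 2 : ℝ) * z + (Real.sqrt 3 : ℝ) * w) := by
  have h2 : 0 < Real.sqrt 2 := Real.sqrt_pos.2 (by norm_num)
  have h3 : 0 < Real.sqrt 3 := Real.sqrt_pos.2 (by norm_num)
  have hν : ((1 : ℝ) / ((Polynomial.X : Polynomial ℂ).natDegree + 1) - Real.sqrt 3) / Real.sqrt 2 < 1 := by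
    rw [Polynomial.natDegree_X, div_lt_one h2]
    have : (1 : ℝ) < Real.sqrt 3 := by
      rw [show (1 : ℝ) = Real.sqrt 1 by simp]
      exact Real.sqrt_lt_sqrt (by norm_num) (by norm_num)
    norm_num
    linarith
  obtain ⟨z, w, hz, hw⟩ := exists_expPoint_mixed_diag h2.ne' h3.ne' 0 Polynomial.X_ne_zero
    (Polynomial.C 1) (Or.inr (by rw [Polynomial.natDegree_C, Polynomial.natDegree_X]; exact one_pos)) hν
  refine ⟨z, w, ?_, ?_⟩
  · rw [hz, Polynomial.eval_X, add_zero, ← Complex.exp_add, ← two_mul]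
  · rw [hw, Polynomial.eval_C, mul_one, add_zero]

end Diag

end Summit.Schanuel.Schanuel.Theorems

end
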